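import Summits.ResolutionOfSingularities.ResolutionOfSingularities.Theorems.FrobeniusLadderFInjectiveMacaulayficationRelClosedFixR
import Literature.AlgebraicGeometry.Resolution.MarkedIdealsLemmas
import HarnessLib

/-!
# PRODUCT GLUING of two disjointly supported cures in `GoodOver` currency (cluster growth, first lemma)
# (crux `FInjectiveMacaulayfication` stmt-ResolutionOfSingularities-15315, chain w45a; res-L1-w45a-plan-1 R16.39 (2) «`goodOver_mul_of_disjoint` + the base-locality
# fact: over `X₁ ∖ supp J′`, `Bl_{JJ′}` is `Bl_J`»; seat res-L1-w45a-stub-2)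

[OURS · L1 W4.5a] Support file (`--supports stmt-ResolutionOfSingularities-15315 --as helper`); NOT a statement of any manuscript; def-free, unconditional;
AI-written (AI review is weaker than expert review).

`goodOver_mul_of_disjoint : GoodOver p X₁ J U → GoodOver p X₁ J′ U′ → Disjoint U J′.support → Disjoint U′ J.support → GoodOver p X₁ (J * J′) (U ∪ U′)`
(`X₁` locally Noetherian and Jacobson): off `supp J′` the product `J·J′` has the stalks of `J` (`stalkIdeal_mul`, `stalkIdeal_eq_top_of_not_mem_support`),
so every blow-up along `J·J′` is, over `X₁ ∖ supp J′`, a blow-up along `J` (base locality in `GoodOver` currency =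
`RelClosedSubsetFixFinite.goodOver_of_stalkIdeal_eq_off_closed`, res-L1-w45a-stub-1); symmetrically off `supp J`; glue with `RelClosedFixR.goodOver_union`.
[cite: GortzWedhorn2020, Prop. 13.91]
-/

-- single-problem summit: the doubled namespace component is forced
set_option linter.dupNamespace false

noncomputable section

namespace Summit.ResolutionOfSingularities.ResolutionOfSingularities.Theorems.FInjectiveMacaulayfication.GoodOverMul

open CategoryTheory AlgebraicGeometry TopologicalSpace
open Literature.AlgebraicGeometry.Resolution
open Summit.ResolutionOfSingularities.ResolutionOfSingularities.Theorems.FInjectiveMacaulayfication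
open FCUnguardedAprime

variable {X₁ : Scheme.{0}}

/-- Off `supp J′`, the product `J·J′` has the stalks of `J`. [folklore] -/
theorem stalkIdeal_mul_eq_of_notMem_support (J J' : X₁.IdealSheafData) {x : X₁} (hx : x ∉ J'.support) :
    stalkIdeal (J * J') x = stalkIdeal J x := by
  rw [stalkIdeal_mul, stalkIdeal_eq_top_of_not_mem_support hx, Ideal.mul_top]

/-- Off `supp J`, the product `J·J′` has the stalks of `J′`. [folklore] -/
theorem stalkIdeal_mul_eq_of_notMem_support' (J J' : X₁.IdealSheafData) {x : X₁} (hx : x ∉ J.support) :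
    stalkIdeal (J * J') x = stalkIdeal J' x := by
  rw [stalkIdeal_mul, stalkIdeal_eq_top_of_not_mem_support hx, Ideal.top_mul]

/-- **Base locality for the product, one factor**: blow-ups along `J·J′` are good over `S ∖ supp J′` as soon as blow-ups along `J` are good over `S`.
[folklore; cite: GortzWedhorn2020, Prop. 13.91] -/
theorem goodOver_mul_diff_support [IsLocallyNoetherian X₁] [JacobsonSpace X₁] {p : ℕ} {J J' : X₁.IdealSheafData} {S : Set X₁}
    (h : GoodOver p X₁ J S) : GoodOver p X₁ (J * J') (S \ (J'.support : Set X₁)) :=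
  RelClosedSubsetFixFinite.goodOver_of_stalkIdeal_eq_off_closed J'.support.isClosed
    (fun _ hx => stalkIdeal_mul_eq_of_notMem_support J J' hx) h

/-- The same for the other factor: good over `S ∖ supp J` if blow-ups along `J′` are good over `S`. [folklore] -/
theorem goodOver_mul_diff_support' [IsLocallyNoetherian X₁] [JacobsonSpace X₁] {p : ℕ} {J J' : X₁.IdealSheafData} {S : Set X₁}
    (h : GoodOver p X₁ J' S) : GoodOver p X₁ (J * J') (S \ (J.support : Set X₁)) :=
  RelClosedSubsetFixFinite.goodOver_of_stalkIdeal_eq_off_closed J.support.isClosed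
    (fun _ hx => stalkIdeal_mul_eq_of_notMem_support' J J' hx) h

/-- **PRODUCT GLUING** (R16.39 (2)): two cures with disjointly placed good sets glue — if blow-ups along `J` are good over `U`, blow-ups along `J′`
are good over `U′`, `U` misses `supp J′` and `U′` misses `supp J`, then blow-ups along `J·J′` are good over `U ∪ U′`. [OURS · folklore plumbing]
[cite: GortzWedhorn2020, Prop. 13.91] -/
theorem goodOver_mul_of_disjoint [IsLocallyNoetherian X₁] [JacobsonSpace X₁] {p : ℕ} {J J' : X₁.IdealSheafData} {U U' : Set X₁}
    (hJ : GoodOver p X₁ J U) (hJ' : GoodOver p X₁ J' U') (hU : Disjoint U (J'.support : Set X₁)) (hU' : Disjoint U' (J.support : Set X₁)) :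
    GoodOver p X₁ (J * J') (U ∪ U') := by
  have h1 : GoodOver p X₁ (J * J') U := by
    have h := goodOver_mul_diff_support (J' := J') hJ
    rwa [hU.sdiff_eq_left] at h
  have h2 : GoodOver p X₁ (J * J') U' := by
    have h := goodOver_mul_diff_support' (J := J) hJ'
    rwa [hU'.sdiff_eq_left] at h
  exact RelClosedFixR.goodOver_union h1 h2

end Summit.ResolutionOfSingularities.ResolutionOfSingularities.Theorems.FInjectiveMacaulayfication.GoodOverMul

end
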